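import Summits.QuantumFields.YangMills.Theorems.BalabanLadderUVSeamRecClassicalResponseThermalFloorResponseMoments
import Literature.MathematicalPhysics.QuantumFieldTheory.WilsonPlaquetteWeakCouplingFloorSU2
import Summits.QuantumFields.YangMills.Theorems.BalabanLadderIRAfOnsetPlaquetteMoments
import HarnessLib

/-!
# Crux `UVSeamRec` (stmt-QuantumFields-20043): the TORUS THERMAL CEILING `⟨2 − plane⟩_{2L+1,β} ≤ (K + log β)/β`, uniformly in
# the volume, and the LOWER pinning of the (RM) reference — the ∃-reference of the registered stub IS the perturbative plaquette mean

Helper file (`--supports stmt-QuantumFields-20043`) of the LEAD seat `ym-spine-20043-p1` (gen 11), sequel of the «thermal floor» files of gen 10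
(`…ClassicalResponseThermalFloorResponseMoments`: `torusE_plane_le`, `responseMoments_ref_le` — the reference of (RM) sits `Θ(1/β)` BELOW `N = 2`).
Sizing of record: tempered-d1 g5 `MEMO-D1-g5-coldwall-ceiling.md` (a653c5bc1ae31a2e) Tier 1; director-ym R395.

WHAT IS PROVED (all `SU(2)`, fundamental representation, tree units `β = β_W/2`):
* `torusE_plane_eq_wilsonExpectation` — dictionary: the crux's torus mean `⟨plane q x⟩_{2L+1,β}` is the Literature torus expectation
  `⟨Re tr U_{x̄,q}⟩_{Λ_{2L+1},β}` of `ConstructiveQFTWave0.wilsonExpectation`;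
* **`torusE_plane_ge`** — for every `β ≥ 2/3`, EVERY torus `L`, orientation `q.1 < q.2` and site `x`:
  `2 − 2(9 + 2 log(3β))/(3β) ≤ ⟨plane q x⟩_{2L+1,β}`, i.e. `⟨2 − Re tr U_p⟩ ≤ (18 + 4 log(3β))/(3β)` UNIFORMLY IN THE VOLUME — the Literature's
  explicit weak-coupling floor `WilsonPlaquetteWeakCouplingFloorSU2.wilsonExpectation_plaquette_ge_su2_dim_four` (Jensen/convexity bound
  `β⟨S⟩_β ≤ −log Z(β)` + the link-ball lower bound on `Z` at radius `β^{-1/2}` + the `SU(2)` small-ball volume) read in the crux letters;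
  `torusE_plane_ge'` — the memorable form `2 − 8(1 + log β)/β ≤ ⟨plane q x⟩_{2L+1,β}` for `β ≥ 1`;
* `torusE_plane_eq_integral_plaqRe`, **`exists_torusE_plane_ge`** — the same for EVERY compact `G` and lattice representation `r` with an
  inexplicit constant: `∃ K ≥ 0, ∀ L ≥ 1, β ≥ 1, q.1 < q.2, x: N − K(1 + log β)/β ≤ ⟨plane q x⟩_{2L+1,β}` (af-pincer's chessboard plaquette moments
  `AfOnset.exists_plaquetteCost_moments_le`, 19353 g8's `CouplingSumRule.exists_six_mul_sub_torusE_dens_le` per orientation);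
* **`responseMoments_ref_ge`** — seam-s2's `hRM` binder VERBATIM (the (RM) inequality family at unit `a`, constants `C₁ > 0, B, β₁, ℓ₁`, reference `p`)
  forces `2 − 8(1 + log β)/β − C₁(e^B − 1)/R⁴ ≤ p q β` for `β ≥ β₁`, `β ≥ 1`, `1 ≤ R`, `R·a β ≤ ℓ₁` (pinning to the torus mean on `L = 4R+8`,
  `ResponsePinning.abs_torusE_plane_sub_le_of_responseMoments`, plus `torusE_plane_ge'`);
* **`responseMoments_ref_mem_Icc`** — with gen 10's `responseMoments_ref_le`: `p q β ∈ [2 − 8(1+log β)/β − C₁(e^B−1)/R⁴, 2 − 6/(24β+3) + C₁(e^B−1)/R⁴]`;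
* **`responseMomentsOdd6SU2_body_ref_pinned`** — the same read on the REGISTERED text (`ResponseMomentsDefs.ResponseMomentsOdd6SU2`, v5(α) stub
  `stub_responseMomentsOdd6`, skeleton afcf556d5b76a240): EVERY witness `(a, c, C₁, B, β₁, ℓ₁, P₀, p)` of its body has
  `|p q β − 2| ≤ 8(1 + log β)/β + C₁(e^B − 1)/R⁴` and `6/(24β+3) − C₁(e^B − 1)/R⁴ ≤ 2 − p q β` on the window.

READING (numbers).  TWO-SIDED and hypothesis-free: the reference values of any closer of `stub_responseMomentsOdd6` are the β-dependent plaquette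
means, `2 − p q β ∈ [1/(4β) − o(1), 8(1 + log β)/β + o(1)]` (`o(1) = C₁(e^B − 1)/R⁴ ≍ (c·uRec β/ℓ₁)⁴` along the window) — perturbatively `3/(4β)`.
The `log β` is convexity slack of the chord `[0, β]` (tempered-d1 memo §Tier 2); removing it needs maximal-tree gauge fixing (not here).
HONEST FRAMING: necessary conditions on the ∃-witness of an OPEN registered stub + a dictionary lemma; nothing of E0′, NT or the gap; not Clay.
-/

set_option autoImplicit false

noncomputable section

open MeasureTheory Filter Topology
open Literature.MathematicalPhysics.QuantumFieldTheory (LatticeRep wilsonExpectation plaquetteHolonomy GaugeConfig wilsonMeasure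
  isProbabilityMeasure_wilsonMeasure plaquetteCost wilsonExpectation_plaquette_ge_su2_dim_four)
open Literature.MathematicalPhysics.QuantumFieldTheory.WilsonRP (plaqRe abs_plaqRe_le measurable_plaqRe)
open Summit.QuantumFields.YangMills.Cruxes.IR.AfOnset (exists_plaquetteCost_moments_le)
open Literature.MathematicalPhysics.QuantumLattice (LGConfig fundamentalLatticeRep fundamentalRep plaquetteObs configShift torusLift)
open Summit.QuantumFields.YangMills.Cruxes.OSLegsFromFemtoAndGap.DlrCollarTransfer
open Summit.QuantumFields.YangMills.Cruxes.UVSeamRec.ResponsePinning (abs_torusE_plane_sub_le_of_responseMoments)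

namespace Summit.QuantumFields.YangMills.Cruxes.UVSeamRec.ClassicalResponse.ThermalFloor

/-- **Dictionary.**  The crux's torus mean of the plane field `plane q x` on the odd torus `(ℤ/(2L+1))⁴` is the Literature torus expectation of
`Re tr U_{x̄, q}` (`x̄` the projection of `x`), for the defining representation of `SU(2)`. [folklore] -/
theorem torusE_plane_eq_wilsonExpectation (β : ℝ) (L : ℕ) (q : Fin 4 × Fin 4) (x : Fin 4 → ℤ) :
    torusE (Matrix.specialUnitaryGroup (Fin 2) ℂ) (fundamentalLatticeRep 2) β L
        (plane (Matrix.specialUnitaryGroup (Fin 2) ℂ) (fundamentalLatticeRep 2) q x) =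
      wilsonExpectation (d := 4) (L := 2 * L + 1) (fundamentalRep (Fin 2)) β
        (fun U => (fundamentalRep (Fin 2)
          (plaquetteHolonomy U (Literature.Probability.LatticeModels.Torus.proj (2 * L + 1) x) q.1 q.2)).trace.re) := by
  unfold torusE wilsonExpectation
  refine integral_congr_ae (ae_of_all _ fun U => ?_)
  show plaquetteObs (fundamentalLatticeRep 2).ρ 0 q.1 q.2 (configShift (-x) (torusLift (2 * L + 1) U)) = _
  rw [Summit.QuantumFields.YangMills.Theorems.CurvatureBoostCovariance.Negative.plaquetteObs_configShift_torusLift]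
  rfl

/-- **THE TORUS THERMAL CEILING, uniformly in the volume (explicit).**  For every `β ≥ 2/3`, every torus size `L`, orientation `q.1 < q.2` and site
`x`: `2 − 2(9 + 2 log(3β))/(3β) ≤ ⟨plane q x⟩_{2L+1,β}`, i.e. `⟨2 − Re tr U_p⟩_{2L+1,β} ≤ (18 + 4 log(3β))/(3β)` — the Literature's explicit
weak-coupling plaquette floor for `SU(2)` in `d = 4` read in the crux letters. [cite: MontvayMunster1994, §3.2 (3.113), PDF p. 123]
[cite: FriedliVelenik2017, Lemma 3.5 (p. 94), App. B.8.1] -/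
theorem torusE_plane_ge {β : ℝ} (hβ : 2 / 3 ≤ β) (L : ℕ) (q : Fin 4 × Fin 4) (hq : q.1 < q.2) (x : Fin 4 → ℤ) :
    2 - 2 * (9 + 2 * Real.log (3 * β)) / (3 * β) ≤
      torusE (Matrix.specialUnitaryGroup (Fin 2) ℂ) (fundamentalLatticeRep 2) β L
        (plane (Matrix.specialUnitaryGroup (Fin 2) ℂ) (fundamentalLatticeRep 2) q x) := by
  rw [torusE_plane_eq_wilsonExpectation]
  have h := wilsonExpectation_plaquette_ge_su2_dim_four (L := 2 * L + 1) hβ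
    (Literature.Probability.LatticeModels.Torus.proj (2 * L + 1) x) hq.ne
  have hlin : wilsonExpectation (d := 4) (L := 2 * L + 1) (fundamentalRep (Fin 2)) β
      (fun U : GaugeConfig 4 (2 * L + 1) (Matrix.specialUnitaryGroup (Fin 2) ℂ) =>
        ((2 : ℕ) : ℝ)⁻¹ * (fundamentalRep (Fin 2)
          (plaquetteHolonomy U (Literature.Probability.LatticeModels.Torus.proj (2 * L + 1) x) q.1 q.2)).trace.re) =
      ((2 : ℕ) : ℝ)⁻¹ * wilsonExpectation (d := 4) (L := 2 * L + 1) (fundamentalRep (Fin 2)) β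
      (fun U => (fundamentalRep (Fin 2)
          (plaquetteHolonomy U (Literature.Probability.LatticeModels.Torus.proj (2 * L + 1) x) q.1 q.2)).trace.re) := by
    unfold wilsonExpectation
    exact integral_const_mul _ _
  rw [hlin] at h
  push_cast at h
  have e : 2 * (9 + 2 * Real.log (3 * β)) / (3 * β) = 2 * ((9 + 2 * Real.log (3 * β)) / (3 * β)) := by ring
  rw [e]
  linarith

/-- `log 3 ≤ 7/5` (`log 3 ≤ log 4 = 2 log 2 < 1.3863`). [folklore] -/
private theorem log_three_le : Real.log 3 ≤ 7 / 5 := by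
  have h1 : Real.log 3 ≤ Real.log 4 := Real.log_le_log (by norm_num) (by norm_num)
  have h2 : Real.log 4 = 2 * Real.log 2 := by
    rw [show (4 : ℝ) = 2 ^ 2 by norm_num, Real.log_pow]; norm_num
  linarith [Real.log_two_lt_d9]

/-- **Memorable form**: for `β ≥ 1`, every `L`, `q.1 < q.2`, `x`: `2 − 8(1 + log β)/β ≤ ⟨plane q x⟩_{2L+1,β}`
(`2(9 + 2 log 3 + 2 log β)/3 ≤ 8(1 + log β)` as `log 3 ≤ 7/5`). [folklore] -/
theorem torusE_plane_ge' {β : ℝ} (hβ : 1 ≤ β) (L : ℕ) (q : Fin 4 × Fin 4) (hq : q.1 < q.2) (x : Fin 4 → ℤ) :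
    2 - 8 * (1 + Real.log β) / β ≤
      torusE (Matrix.specialUnitaryGroup (Fin 2) ℂ) (fundamentalLatticeRep 2) β L
        (plane (Matrix.specialUnitaryGroup (Fin 2) ℂ) (fundamentalLatticeRep 2) q x) := by
  have hβ0 : 0 < β := lt_of_lt_of_le one_pos hβ
  have h := torusE_plane_ge (β := β) (by linarith) L q hq x
  have hlog : Real.log (3 * β) = Real.log 3 + Real.log β := Real.log_mul (by norm_num) hβ0.ne'
  have hlogβ : 0 ≤ Real.log β := Real.log_nonneg hβ
  have hle : 2 * (9 + 2 * Real.log (3 * β)) / (3 * β) ≤ 8 * (1 + Real.log β) / β := by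
    rw [hlog, div_le_div_iff₀ (by positivity) hβ0]
    nlinarith [log_three_le, hlogβ, hβ0]
  linarith

section General

variable (G : Type) [Group G] [TopologicalSpace G] [IsTopologicalGroup G] [CompactSpace G]
  [MeasurableSpace G] [BorelSpace G] (r : LatticeRep G)

/-- **Dictionary (general `(G, r)`).**  The torus mean of the plane field is the Wilson-measure integral of `Re tr r(U_{x̄,q})` on the torus of side
`2L+1`. [folklore] -/
theorem torusE_plane_eq_integral_plaqRe (β : ℝ) (L : ℕ) (q : Fin 4 × Fin 4) (hq : q.1 < q.2) (x : Fin 4 → ℤ) :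
    torusE G r β L (plane G r q x) =
      ∫ U, plaqRe r.ρ U (Literature.Probability.LatticeModels.Torus.proj (2 * L + 1) x, ⟨q, hq⟩)
        ∂(wilsonMeasure (d := 4) (L := 2 * L + 1) r.ρ β) := by
  unfold torusE
  refine integral_congr_ae (ae_of_all _ fun U => ?_)
  show plaquetteObs r.ρ 0 q.1 q.2 (configShift (-x) (torusLift (2 * L + 1) U)) = _
  rw [Summit.QuantumFields.YangMills.Theorems.CurvatureBoostCovariance.Negative.plaquetteObs_configShift_torusLift]
  rfl

/-- **THE TORUS THERMAL CEILING for every compact gauge group and lattice representation**: there is `K ≥ 0` (the chessboard constant of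
`AfOnset.exists_plaquetteCost_moments_le`) such that for every odd torus `2L+1 ≥ 3`, every `β ≥ 1`, orientation `q.1 < q.2` and site `x`:
`N − K(1 + log β)/β ≤ ⟨plane q x⟩_{2L+1,β}`, i.e. `⟨N − Re tr r(U_p)⟩_{2L+1,β} ≤ K(1 + log β)/β` UNIFORMLY IN THE VOLUME. [folklore] -/
theorem exists_torusE_plane_ge :
    ∃ K : ℝ, 0 ≤ K ∧ ∀ (L : ℕ), 1 ≤ L → ∀ β : ℝ, 1 ≤ β → ∀ (q : Fin 4 × Fin 4) (hq : q.1 < q.2) (x : Fin 4 → ℤ),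
      (r.N : ℝ) - K * (1 + Real.log β) / β ≤ torusE G r β L (plane G r q x) := by
  obtain ⟨K, hK0, hK⟩ := exists_plaquetteCost_moments_le r
  refine ⟨K, hK0, fun L hL β hβ q hq x => ?_⟩
  haveI := isProbabilityMeasure_wilsonMeasure (d := 4) (L := 2 * L + 1) r.ρ r.continuous β
  set p : Literature.MathematicalPhysics.QuantumFieldTheory.Plaquette 4 (2 * L + 1) :=
    (Literature.Probability.LatticeModels.Torus.proj (2 * L + 1) x, ⟨q, hq⟩) with hp
  have h1 := (hK L hL β hβ p).1
  rw [torusE_plane_eq_integral_plaqRe G r β L q hq x]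
  -- `plaquetteCost = N − plaqRe`, and `plaqRe` is bounded and measurable, hence integrable
  have hint : Integrable (fun U : GaugeConfig 4 (2 * L + 1) G => plaqRe r.ρ U p)
      (wilsonMeasure (d := 4) (L := 2 * L + 1) r.ρ β) :=
    Integrable.of_bound (measurable_plaqRe r.ρ r.continuous p).aestronglyMeasurable (r.N : ℝ)
      (ae_of_all _ fun U => by rw [Real.norm_eq_abs]; exact abs_plaqRe_le r.ρ r.continuous U p)
  have hcost : ∫ U, plaquetteCost r.ρ U p ∂(wilsonMeasure (d := 4) (L := 2 * L + 1) r.ρ β) =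
      (r.N : ℝ) - ∫ U, plaqRe r.ρ U p ∂(wilsonMeasure (d := 4) (L := 2 * L + 1) r.ρ β) := by
    have : (fun U : GaugeConfig 4 (2 * L + 1) G => plaquetteCost r.ρ U p) =
        fun U => (r.N : ℝ) - plaqRe r.ρ U p := rfl
    rw [this, integral_sub (integrable_const _) hint, integral_const, smul_eq_mul]
    simp
  rw [hcost] at h1
  rw [← hp]
  linarith

end General

/-- **(RM) pins its reference value ABOVE `N − O(log β/β)`.**  Under the response-moment family at unit `a` with constants `C₁ > 0`, `B`, `β₁`, `ℓ₁`
and reference `p` (seam-s2's `hRM` binder VERBATIM, `SU(2)` fundamental): for `β ≥ β₁`, `β ≥ 1`, `1 ≤ R`, `R·a β ≤ ℓ₁` and every orientation,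
`2 − 8(1 + log β)/β − C₁(e^B − 1)/R⁴ ≤ p q β` (pinning to the torus mean on the torus `L = 4R+8`, plus `torusE_plane_ge'`). [folklore] -/
theorem responseMoments_ref_ge (a : ℝ → ℝ) {C₁ B β₁ ℓ₁ : ℝ} {p : Fin 4 × Fin 4 → ℝ → ℝ} (hC₁ : 0 < C₁)
    (hRM : ∀ β : ℝ, β₁ ≤ β → ∀ (L n : ℕ) (q : Fin n → Fin 4 × Fin 4) (x : Fin n → (Fin 4 → ℤ)) (R : ℕ),
      (∀ i, (q i).1 < (q i).2) → 1 ≤ R → (R : ℝ) * a β ≤ ℓ₁ → 4 * R + 8 ≤ L →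
      (∀ i j : Fin n, i ≠ j → ∃ k : Fin 4,
        (2 * (R : ℤ) + 4) ≤ |((((x i k - x j k : ℤ) : ZMod (2 * L + 1))).valMinAbs : ℤ)|) →
      ∀ T : Finset (Fin n),
        torusE (Matrix.specialUnitaryGroup (Fin 2) ℂ) (fundamentalLatticeRep 2) β L
          (fun U => Real.exp (∑ i ∈ T, (R : ℝ) ^ 4 / C₁ *
            |kerE (Matrix.specialUnitaryGroup (Fin 2) ℂ) (fundamentalLatticeRep 2) β
              (fun k => x i k - (R + 1)) (2 * R + 3) U
              (plane (Matrix.specialUnitaryGroup (Fin 2) ℂ) (fundamentalLatticeRep 2) (q i) (x i)) -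
              p (q i) β|)) ≤ Real.exp (B * T.card))
    {β : ℝ} (hβ₁ : β₁ ≤ β) (hβ : 1 ≤ β) {R : ℕ} (hR : 1 ≤ R) (hRa : (R : ℝ) * a β ≤ ℓ₁) (q : Fin 4 × Fin 4) (hq : q.1 < q.2) :
    2 - 8 * (1 + Real.log β) / β - C₁ * (Real.exp B - 1) / (R : ℝ) ^ 4 ≤ p q β := by
  have h1 := abs_torusE_plane_sub_le_of_responseMoments (fundamentalLatticeRep 2) a hC₁ hRM hβ₁ (L := 4 * R + 8) q 0 hq hR hRa le_rfl
  have h2 := torusE_plane_ge' hβ (4 * R + 8) q hq 0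
  have h3 := (abs_le.1 h1).2
  linarith

/-- **Two-sided pin of the (RM) reference** (this file's `responseMoments_ref_ge` with gen 10's `responseMoments_ref_le`): under seam-s2's `hRM` binder,
for `β ≥ β₁`, `β ≥ 1`, `1 ≤ R`, `R·a β ≤ ℓ₁`, `q.1 < q.2`:
`p q β ∈ [2 − 8(1 + log β)/β − C₁(e^B − 1)/R⁴, 2 − 6/(24β+3) + C₁(e^B − 1)/R⁴]`. [folklore] -/
theorem responseMoments_ref_mem_Icc (a : ℝ → ℝ) {C₁ B β₁ ℓ₁ : ℝ} {p : Fin 4 × Fin 4 → ℝ → ℝ} (hC₁ : 0 < C₁)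
    (hRM : ∀ β : ℝ, β₁ ≤ β → ∀ (L n : ℕ) (q : Fin n → Fin 4 × Fin 4) (x : Fin n → (Fin 4 → ℤ)) (R : ℕ),
      (∀ i, (q i).1 < (q i).2) → 1 ≤ R → (R : ℝ) * a β ≤ ℓ₁ → 4 * R + 8 ≤ L →
      (∀ i j : Fin n, i ≠ j → ∃ k : Fin 4,
        (2 * (R : ℤ) + 4) ≤ |((((x i k - x j k : ℤ) : ZMod (2 * L + 1))).valMinAbs : ℤ)|) →
      ∀ T : Finset (Fin n),
        torusE (Matrix.specialUnitaryGroup (Fin 2) ℂ) (fundamentalLatticeRep 2) β L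
          (fun U => Real.exp (∑ i ∈ T, (R : ℝ) ^ 4 / C₁ *
            |kerE (Matrix.specialUnitaryGroup (Fin 2) ℂ) (fundamentalLatticeRep 2) β
              (fun k => x i k - (R + 1)) (2 * R + 3) U
              (plane (Matrix.specialUnitaryGroup (Fin 2) ℂ) (fundamentalLatticeRep 2) (q i) (x i)) -
              p (q i) β|)) ≤ Real.exp (B * T.card))
    {β : ℝ} (hβ₁ : β₁ ≤ β) (hβ : 1 ≤ β) {R : ℕ} (hR : 1 ≤ R) (hRa : (R : ℝ) * a β ≤ ℓ₁) (q : Fin 4 × Fin 4) (hq : q.1 < q.2) :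
    p q β ∈ Set.Icc (2 - 8 * (1 + Real.log β) / β - C₁ * (Real.exp B - 1) / (R : ℝ) ^ 4)
      (2 - 6 / (24 * β + 3) + C₁ * (Real.exp B - 1) / (R : ℝ) ^ 4) :=
  ⟨responseMoments_ref_ge a hC₁ hRM hβ₁ hβ hR hRa q hq, responseMoments_ref_le a hC₁ hRM hβ₁ (by linarith) hR hRa q hq⟩

/-- **Read on the REGISTERED text.**  EVERY witness `(a, c, C₁, B, β₁, ℓ₁, P₀, p)` of the body of `ResponseMomentsDefs.ResponseMomentsOdd6SU2` (= the
conclusion of the v5(α) stub `stub_responseMomentsOdd6`, skeleton afcf556d5b76a240) has its reference values pinned to the perturbative plaquette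
mean on the window: for `β ≥ β₁`, `β ≥ 1`, `1 ≤ R`, `R·a β ≤ ℓ₁`, `q.1 < q.2`,
`|p q β − 2| ≤ 8(1 + log β)/β + C₁(e^B − 1)/R⁴` and `6/(24β+3) − C₁(e^B − 1)/R⁴ ≤ 2 − p q β`. [folklore] -/
theorem responseMomentsOdd6SU2_body_ref_pinned (a : ℝ → ℝ) (c C₁ B β₁ ℓ₁ P₀ : ℝ) (p : Fin 4 × Fin 4 → ℝ → ℝ)
    (hbody : 0 < c ∧ (∀ᶠ β in atTop, a β ≤ c * Transport.uRec β) ∧ 0 < ℓ₁ ∧ 0 < C₁ ∧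
      (∀ (q : Fin 4 × Fin 4) (β : ℝ), |p q β| ≤ P₀) ∧
      ∀ β : ℝ, β₁ ≤ β → ∀ (L n : ℕ) (q : Fin n → Fin 4 × Fin 4) (x : Fin n → (Fin 4 → ℤ)) (R : ℕ),
      (∀ i, (q i).1 < (q i).2) → 1 ≤ R → (R : ℝ) * a β ≤ ℓ₁ → 4 * R + 8 ≤ L →
      (∀ i j : Fin n, i ≠ j → ∃ k : Fin 4,
        (2 * (R : ℤ) + 4) ≤ |((((x i k - x j k : ℤ) : ZMod (2 * L + 1))).valMinAbs : ℤ)|) →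
      ∀ T : Finset (Fin n),
        torusE (Matrix.specialUnitaryGroup (Fin 2) ℂ) (fundamentalLatticeRep 2) β L
          (fun U => Real.exp (∑ i ∈ T, (R : ℝ) ^ 4 / C₁ *
            |kerE (Matrix.specialUnitaryGroup (Fin 2) ℂ) (fundamentalLatticeRep 2) β
              (fun k => x i k - (R + 1)) (2 * R + 3) U
              (plane (Matrix.specialUnitaryGroup (Fin 2) ℂ) (fundamentalLatticeRep 2) (q i) (x i)) -
              p (q i) β|)) ≤ Real.exp (B * T.card))
    {β : ℝ} (hβ₁ : β₁ ≤ β) (hβ : 1 ≤ β) {R : ℕ} (hR : 1 ≤ R) (hRa : (R : ℝ) * a β ≤ ℓ₁)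
    (q : Fin 4 × Fin 4) (hq : q.1 < q.2) :
    |p q β - 2| ≤ 8 * (1 + Real.log β) / β + C₁ * (Real.exp B - 1) / (R : ℝ) ^ 4 ∧
      6 / (24 * β + 3) - C₁ * (Real.exp B - 1) / (R : ℝ) ^ 4 ≤ 2 - p q β := by
  obtain ⟨-, -, -, hC₁, -, hRM⟩ := hbody
  have h := responseMoments_ref_mem_Icc a hC₁ hRM hβ₁ hβ hR hRa q hq
  have hβ0 : 0 < β := lt_of_lt_of_le one_pos hβ
  have hfl : 0 < 6 / (24 * β + 3) := by positivity
  have hK : 0 ≤ 8 * (1 + Real.log β) / β := div_nonneg (by nlinarith [Real.log_nonneg hβ]) hβ0.le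
  refine ⟨abs_le.2 ⟨by linarith [h.1], by linarith [h.2]⟩, by linarith [h.2]⟩

end Summit.QuantumFields.YangMills.Cruxes.UVSeamRec.ClassicalResponse.ThermalFloor

end
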